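import Literature.MathematicalPhysics.KineticTheory.LangevinChainLocalMinorization

/-!
# A local small set of the pinned chain at the equilibrium, UNIFORM in the bath temperatures
(helper for stub S2a `stub_uniformAsymmetryTransfer`, line `fekete-usc-one-length`)

`--supports stmt-AtomisticToContinuum-11976` helper file (crux `VanishingNoiseBound`).
`pinnedChain_minorization_at_one` (`LangevinChainLocalMinorization.lean`) gives `ε₁, r, c > 0` with
`P_1(z, T) ≥ c · Leb(T)` (`T ⊆ B(0,r)`, `‖z‖ < ε₁`) at FIXED temperatures: the amplitudes
`c_b = √(2γT_b)` sit inside the skeleton map fed to the submersion lemma. Here they are moved into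
the LAW of the skeleton: `Φ_1(z) = S₁(z, D_c Ξ, ρ)(1)` for the skeleton map `S₁` at UNIT
amplitudes, the scaled Gaussian skeleton `D_c Ξ = (c_L Ξ¹, c_R Ξ²)` and the scaled remainder `ρ`
(`solMap_one_pairRecon_eq_skelSol_smul`); the law of `D_c Ξ` dominates Lebesgue measure on balls
uniformly for amplitudes in `[c_min, c_max] ∌ 0` (`exists_map_pairSkel_preimage_smul_ge`, change of
variables, `det D_c = (c_L c_R)^{2^m}`). Result: `pinnedChain_minorization_at_one_uniform` —
`ε₁, r, c` valid for ALL temperatures with amplitudes in `[c_min, c_max]`. No definitions.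
-/

noncomputable section

open MeasureTheory ProbabilityTheory Filter Topology Set Metric Function unitInterval
open scoped NNReal ENNReal

namespace Summit.AtomisticToContinuum.FouriersLaw.Theorems.FixedLengthNoiseContinuity

open Literature.MathematicalPhysics.KineticTheory.HeatConduction
open Literature.Probability.Process Literature.Analysis.ODE Literature.Analysis.Calculus OscillatorChain

variable {N : ℕ}

/-! ### The law of the scaled skeleton dominates Lebesgue measure on balls, uniformly -/

/-- **Scaled Gaussian skeletons dominate Lebesgue measure on balls, uniformly in the scaling**:
for `0 < c_min ≤ c_max` and `R` there is `c > 0` with `law(Ξ)(D⁻¹A) ≥ c · Leb(A)` for measurable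
`A ⊆ B̄(0, R)` and `D(x) = (c_L x¹, c_R x²)`, `c_L, c_R ∈ [c_min, c_max]` (`exists_wienerPair_map_pairSkel_ge`
on `B̄(0, R/c_min) ⊇ D⁻¹B̄(0,R)`; `Leb(D⁻¹A) = (c_L c_R)^{-2^m} Leb(A) ≥ c_max^{-2^{m+1}} Leb(A)`). -/
theorem exists_map_pairSkel_preimage_smul_ge (m : ℕ) {cmin cmax : ℝ} (h0 : 0 < cmin)
    (hle : cmin ≤ cmax) (R : ℝ) :
    ∃ c : ℝ≥0∞, 0 < c ∧ ∀ cL cR : ℝ, cmin ≤ cL → cL ≤ cmax → cmin ≤ cR → cR ≤ cmax →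
      ∀ A : Set (PairSkeleton m), A ⊆ closedBall 0 R → MeasurableSet A →
        c * volume A ≤
          wienerPair.map (pairSkel m) ((fun x : PairSkeleton m => (cL • x.1, cR • x.2)) ⁻¹' A) := by
  classical
  haveI hpiS : (volume : Measure (Fin (2 ^ m) → ℝ)).IsAddHaarMeasure := isAddHaarMeasure_volume_pi _
  haveI hvolS : (volume : Measure (PairSkeleton m)).IsAddHaarMeasure :=
    Measure.prod.instIsAddHaarMeasure (volume : Measure (Fin (2 ^ m) → ℝ)) (volume : Measure (Fin (2 ^ m) → ℝ))
  obtain ⟨c₂, hc₂, hskel⟩ := exists_wienerPair_map_pairSkel_ge m (R / cmin)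
  have hcmax : 0 < cmax := h0.trans_le hle
  set n : ℕ := 2 ^ m with hn
  set κ : ℝ := (cmax ^ n * cmax ^ n)⁻¹ with hκ
  have hκ0 : 0 < κ := by positivity
  refine ⟨c₂ * ENNReal.ofReal κ, ENNReal.mul_pos hc₂.ne' (ENNReal.ofReal_pos.2 hκ0).ne',
    fun cL cR hL1 hL2 hR1 hR2 A hA hAm => ?_⟩
  have hcL : 0 < cL := h0.trans_le hL1; have hcR : 0 < cR := h0.trans_le hR1
  -- the scaling as a linear map, and its determinant
  set D : PairSkeleton m →ₗ[ℝ] PairSkeleton m :=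
    LinearMap.prodMap (cL • LinearMap.id) (cR • LinearMap.id) with hD
  have hDapply : ∀ x : PairSkeleton m, D x = (cL • x.1, cR • x.2) := fun x => rfl
  have hDfun : (fun x : PairSkeleton m => (cL • x.1, cR • x.2)) = D := funext fun x => rfl
  have hdet : LinearMap.det D = cL ^ n * cR ^ n := by
    rw [hD, LinearMap.det_prodMap, LinearMap.det_smul, LinearMap.det_smul, LinearMap.det_id,
      Module.finrank_fin_fun]
    ring
  have hdet0 : LinearMap.det D ≠ 0 := by rw [hdet]; positivity
  -- `D⁻¹ A ⊆ B̄(0, R/c_min)`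
  have hsub : D ⁻¹' A ⊆ closedBall (0 : PairSkeleton m) (R / cmin) := by
    intro x hx
    have hxA : ‖D x‖ ≤ R := by simpa [dist_zero_right] using hA hx
    rw [mem_closedBall, dist_zero_right, le_div_iff₀ h0]
    rw [hDapply, Prod.norm_def, norm_smul, norm_smul, Real.norm_of_nonneg hcL.le,
      Real.norm_of_nonneg hcR.le] at hxA
    obtain ⟨h1, h2⟩ := max_le_iff.1 hxA
    rw [Prod.norm_def, max_mul_of_nonneg _ _ h0.le]
    exact max_le (by nlinarith [norm_nonneg x.1]) (by nlinarith [norm_nonneg x.2])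
  have hDm : MeasurableSet (D ⁻¹' A) := hAm.preimage D.continuous_of_finiteDimensional.measurable
  -- change of variables
  have hvol := Measure.addHaar_preimage_linearMap volume hdet0 A
  have hκle : κ ≤ |(LinearMap.det D)⁻¹| := by
    rw [hdet, abs_of_pos (by positivity), hκ]
    exact inv_anti₀ (by positivity) (mul_le_mul (pow_le_pow_left₀ hcL.le hL2 n)
      (pow_le_pow_left₀ hcR.le hR2 n) (by positivity) (by positivity))
  rw [hDfun]
  calc c₂ * ENNReal.ofReal κ * volume A ≤ c₂ * (ENNReal.ofReal |(LinearMap.det D)⁻¹| * volume A) := by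
        rw [mul_assoc]; exact mul_le_mul' le_rfl (mul_le_mul' (ENNReal.ofReal_le_ofReal hκle) le_rfl)
    _ = c₂ * volume (D ⁻¹' A) := by rw [hvol]
    _ ≤ wienerPair.map (pairSkel m) (D ⁻¹' A) := hskel _ hsub hDm

/-! ### The solution map through a reconstructed pair, amplitudes on the skeleton -/

section Recon

variable {ω₂ lam β γ : ℝ} (hω : 0 < ω₂) (hl : 0 ≤ lam) (hβ : 0 ≤ β) (hγ : 0 ≤ γ) (T_L T_R : ℝ)
  (m : ℕ)
  (η : PairSkeleton m → C(I, Fin N → ℝ) → ℝ → Fin N → ℝ)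
  (hη : ∀ (x : PairSkeleton m) (ρ : C(I, Fin N → ℝ)) (t : ℝ) (i : Fin N),
    η x ρ t i = ρ (projIcc 0 1 zero_le_one t) i +
      ((if i.val = 0 then (1 : ℝ) else 0) * plInterp m x.1 t.toNNReal +
        (if i.val = N - 1 then (1 : ℝ) else 0) * plInterp m x.2 t.toNNReal))
include hω hl hβ hγ hη

/-- **The SDE solution at time `1` through a reconstructed pair, amplitudes on the skeleton**: for
the skeleton solution map `S` at UNIT amplitudes, a skeleton `x`, continuous remainders `r`,
`r(0) = 0`, and `ρ_r(τ) = (c_L r¹_τ e_0 + c_R r²_τ e_{N-1})`, `c_b = √(2γT_b)`: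
`Φ_1(z, PL(x) + r) = S(z, (c_L x¹, c_R x²), ρ_r)(1)` (`plInterp` is linear). -/
theorem solMap_one_pairRecon_eq_skelSol_smul
    {S : PhaseSpace N × PairSkeleton m × C(I, Fin N → ℝ) → C(I, PhaseSpace N)}
    (hS : ∀ p τ, S p τ = (pinnedChain ω₂ lam β γ).chainFlow N p.1 (η p.2.1 p.2.2) τ)
    (x : PairSkeleton m) {r : WienerPair} (hr1 : Continuous r.1) (hr2 : Continuous r.2)
    (hr10 : r.1 0 = 0) (hr20 : r.2 0 = 0) (ρr : C(I, Fin N → ℝ))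
    (hρr : ∀ (τ : I) (i : Fin N), ρr τ i =
      (if i.val = 0 then Real.sqrt (2 * γ * T_L) else 0) * r.1 ⟨(τ : ℝ), τ.2.1⟩ +
        (if i.val = N - 1 then Real.sqrt (2 * γ * T_R) else 0) * r.2 ⟨(τ : ℝ), τ.2.1⟩)
    (z : PhaseSpace N) :
    (pinnedChain ω₂ lam β γ).solMap N T_L T_R 1 z (pairRecon m x r) =
      S (z, (Real.sqrt (2 * γ * T_L) • x.1, Real.sqrt (2 * γ * T_R) • x.2), ρr) 1 := by
  -- adapted from `solMap_one_pairRecon_eq_skelSol` (Literature/…/LangevinChainLocalMinorization.lean)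
  set P := pinnedChain ω₂ lam β γ with hP
  set cL : ℝ := Real.sqrt (2 * γ * T_L); set cR : ℝ := Real.sqrt (2 * γ * T_R)
  have hηc := continuous_skelNoise m _ _ η hη (cL • x.1, cR • x.2) ρr
  have hc1 : Continuous (pairRecon m x r).1 := (continuous_plInterp m x.1).add hr1
  have hc2 : Continuous (pairRecon m x r).2 := (continuous_plInterp m x.2).add hr2
  rw [hS]
  show P.chainFlow N z (chainNoise N (Real.sqrt (2 * P.γ * T_L)) (Real.sqrt (2 * P.γ * T_R))
    (pairRecon m x r)) 1 = P.chainFlow N z (η (cL • x.1, cR • x.2) ρr) ((1 : I) : ℝ)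
  have hγP : P.γ = γ := rfl
  rw [hγP]
  refine pinnedChain_chainFlow_congr hω hl hβ hγ N z (continuous_chainNoise _ _ _) hηc
    (T := 1) (fun t ht => ?_) ⟨zero_le_one, le_rfl⟩
  funext i
  rw [chainNoise_of_continuous _ _ hc1 hc2, hη]
  have hproj : projIcc 0 1 zero_le_one t = ⟨t, ht⟩ := projIcc_of_mem zero_le_one ht
  rw [hproj, hρr]
  have htnn : t.toNNReal = ⟨t, ht.1⟩ := Real.toNNReal_of_nonneg ht.1
  have h10 : (pairRecon m x r).1 0 = 0 := by
    show plInterp m x.1 0 + r.1 0 = 0; rw [plInterp_time_zero, hr10, add_zero]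
  have h20 : (pairRecon m x r).2 0 = 0 := by
    show plInterp m x.2 0 + r.2 0 = 0; rw [plInterp_time_zero, hr20, add_zero]
  have h1 : (pairRecon m x r).1 t.toNNReal = plInterp m x.1 t.toNNReal + r.1 ⟨t, ht.1⟩ := by
    show plInterp m x.1 t.toNNReal + r.1 t.toNNReal = _; rw [htnn]
  have h2 : (pairRecon m x r).2 t.toNNReal = plInterp m x.2 t.toNNReal + r.2 ⟨t, ht.1⟩ := by
    show plInterp m x.2 t.toNNReal + r.2 t.toNNReal = _; rw [htnn]
  simp only [h10, h20, sub_zero, h1, h2, plInterp_smul, ite_mul, one_mul, zero_mul]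
  split_ifs <;> ring

end Recon


section One

variable {ω₂ lam β γ : ℝ} (hω : 0 < ω₂) (hl : 0 ≤ lam) (hβ : 0 < β) (hγ : 0 < γ) (hN : 0 < N)
include hω hl hβ hγ hN

/-- **Local minorisation of the pinned chain at time one near the equilibrium, UNIFORM in the bath
temperatures** (Hörmander-free): for `0 < c_min ≤ c_max` there are `ε₁, r, c > 0` with
`P_1(z, T) ≥ c · Leb(T)` for every measurable `T ⊆ B(0, r)`, every `‖z‖ < ε₁` and EVERY pair of
temperatures with amplitudes `√(2γT_b) ∈ [c_min, c_max]`. Proof of `pinnedChain_minorization_at_one`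
with the skeleton map at unit amplitudes (`solMap_one_pairRecon_eq_skelSol_smul`), the scaled
skeleton law (`exists_map_pairSkel_preimage_smul_ge`) and the remainder smallness through `c_max`. -/
theorem pinnedChain_minorization_at_one_uniform {cmin cmax : ℝ} (hc0 : 0 < cmin) (hcle : cmin ≤ cmax) :
    ∃ ε₁ : ℝ, 0 < ε₁ ∧ ∃ r : ℝ, 0 < r ∧ ∃ c : ℝ≥0∞, 0 < c ∧
      ∀ T_L T_R : ℝ, cmin ≤ Real.sqrt (2 * γ * T_L) → Real.sqrt (2 * γ * T_L) ≤ cmax →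
        cmin ≤ Real.sqrt (2 * γ * T_R) → Real.sqrt (2 * γ * T_R) ≤ cmax →
        ∀ z : PhaseSpace N, ‖z‖ < ε₁ → ∀ T ⊆ ball (0 : PhaseSpace N) r, MeasurableSet T →
          c * volume T ≤ (pinnedChain ω₂ lam β γ).transitionKernel N T_L T_R 1 z T := by
  -- adapted from `pinnedChain_minorization_at_one` (Literature/…/LangevinChainLocalMinorization.lean)
  classical
  have hcmax : 0 < cmax := hc0.trans_le hcle
  -- the level `m` and the skeleton objects, at UNIT amplitudes
  obtain ⟨m, hm⟩ := pinnedChain_exists_skeleton_level_surjective hω hl hβ.le hγ.le hN one_ne_zero (1 : ℝ)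
  let η : PairSkeleton m → C(I, Fin N → ℝ) → ℝ → Fin N → ℝ := fun x ρ t i =>
    ρ (projIcc 0 1 zero_le_one t) i +
      ((if i.val = 0 then (1 : ℝ) else 0) * plInterp m x.1 t.toNNReal +
        (if i.val = N - 1 then (1 : ℝ) else 0) * plInterp m x.2 t.toNNReal)
  have hη : ∀ (x : PairSkeleton m) (ρ : C(I, Fin N → ℝ)) (t : ℝ) (i : Fin N),
      η x ρ t i = ρ (projIcc 0 1 zero_le_one t) i +
        ((if i.val = 0 then (1 : ℝ) else 0) * plInterp m x.1 t.toNNReal +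
          (if i.val = N - 1 then (1 : ℝ) else 0) * plInterp m x.2 t.toNNReal) := fun _ _ _ _ => rfl
  obtain ⟨g, hg⟩ := exists_skelForcingCLM m 1 1 η hη
  obtain ⟨S, hSapply, hS, huniq, hdiff⟩ := exists_skelSol hω hl hβ.le hγ.le m 1 1 η hη g hg 1 le_rfl
  have hS0 : S 0 = 0 := skelSol_zero hω hl hβ.le hγ.le m 1 1 η hη hSapply
  have hsurjT := hm η hη g hg S hS huniq
  -- the map `f (z, ρ) x = S (z, x, ρ) 1` and its partial differential in `x`
  let ι : PairSkeleton m →L[ℝ] PhaseSpace N × PairSkeleton m × C(I, Fin N → ℝ) :=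
    (ContinuousLinearMap.inr ℝ (PhaseSpace N) (PairSkeleton m × C(I, Fin N → ℝ))).comp
      (ContinuousLinearMap.inl ℝ (PairSkeleton m) C(I, Fin N → ℝ))
  have hι : ∀ x : PairSkeleton m, ι x = ((0 : PhaseSpace N), x, (0 : C(I, Fin N → ℝ))) := fun x => rfl
  let f : PhaseSpace N × C(I, Fin N → ℝ) → PairSkeleton m → PhaseSpace N := fun p x => S (p.1, x, p.2) 1
  let f' : PhaseSpace N × C(I, Fin N → ℝ) → PairSkeleton m → PairSkeleton m →L[ℝ] PhaseSpace N :=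
    fun p x => (ContinuousMap.evalCLM ℝ (1 : I)).comp ((fderiv ℝ S (p.1, x, p.2)).comp ι)
  have hSd : Differentiable ℝ S := hdiff.differentiable one_ne_zero
  have hf' : ∀ p x, HasFDerivAt (f p) (f' p x) x := by
    intro p x
    have hA : HasFDerivAt (fun x : PairSkeleton m => (p.1, x, p.2)) ι x := by
      have h1 : (fun x : PairSkeleton m => (p.1, x, p.2)) = fun x => ι x + (p.1, 0, p.2) := by
        funext x; rw [hι]; simp
      rw [h1]
      exact ι.hasFDerivAt.add_const _
    have hSx := (hSd (p.1, x, p.2)).hasFDerivAt.comp x hA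
    exact (ContinuousMap.evalCLM ℝ (1 : I)).hasFDerivAt.comp x hSx
  have hcontf' : Continuous fun q : (PhaseSpace N × C(I, Fin N → ℝ)) × PairSkeleton m => f' q.1 q.2 := by
    have h1 : Continuous fun q : (PhaseSpace N × C(I, Fin N → ℝ)) × PairSkeleton m =>
        fderiv ℝ S (q.1.1, q.2, q.1.2) :=
      (hdiff.continuous_fderiv one_ne_zero).comp (by fun_prop)
    exact continuous_const.clm_comp (h1.clm_comp continuous_const)
  have hcontf : Continuous fun p : PhaseSpace N × C(I, Fin N → ℝ) => f p 0 :=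
    (ContinuousMap.evalCLM ℝ (1 : I)).continuous.comp (hdiff.continuous.comp (by fun_prop))
  have hf00 : f (0, 0) 0 = 0 := by
    show S ((0 : PhaseSpace N), (0 : PairSkeleton m), (0 : C(I, Fin N → ℝ))) 1 = 0
    have : ((0 : PhaseSpace N), (0 : PairSkeleton m), (0 : C(I, Fin N → ℝ))) = 0 := rfl
    rw [this, hS0]
    rfl
  have hsurj : LinearMap.range (f' (0, 0) 0 : PairSkeleton m →ₗ[ℝ] PhaseSpace N) = ⊤ := by
    have : ((0 : PhaseSpace N), (0 : PairSkeleton m), (0 : C(I, Fin N → ℝ))) = 0 := rfl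
    show LinearMap.range (((ContinuousMap.evalCLM ℝ (1 : I)).comp ((fderiv ℝ S ((0 : PhaseSpace N),
      (0 : PairSkeleton m), (0 : C(I, Fin N → ℝ)))).comp ι)) : PairSkeleton m →ₗ[ℝ] PhaseSpace N) = ⊤
    rw [this]
    exact hsurjT
  -- nontriviality of the skeleton space
  haveI : Nontrivial (PairSkeleton m) := by
    refine ⟨⟨0, (fun _ => 1, 0), fun h => ?_⟩⟩
    have := congrArg (fun q : PairSkeleton m => q.1 ⟨0, Nat.two_pow_pos m⟩) h
    simp at this
  -- Haar instances on the skeleton space and on phase space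
  haveI hpiS : (volume : Measure (Fin (2 ^ m) → ℝ)).IsAddHaarMeasure := isAddHaarMeasure_volume_pi _
  haveI hpiP : (volume : Measure (Fin N → ℝ)).IsAddHaarMeasure := isAddHaarMeasure_volume_pi _
  haveI hvolS : (volume : Measure (PairSkeleton m)).IsAddHaarMeasure :=
    Measure.prod.instIsAddHaarMeasure (volume : Measure (Fin (2 ^ m) → ℝ)) (volume : Measure (Fin (2 ^ m) → ℝ))
  haveI hvolP : (volume : Measure (PhaseSpace N)).IsAddHaarMeasure :=
    Measure.prod.instIsAddHaarMeasure (volume : Measure (Fin N → ℝ)) (volume : Measure (Fin N → ℝ))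
  -- the submersion estimate, uniformly in `(z, ρ)` near `(0, 0)`
  obtain ⟨V, hV, ρ₀, hρ₀, r, hr, c, hc, hmin⟩ :=
    exists_measure_preimage_ge_of_surjective (volume : Measure (PairSkeleton m))
      (volume : Measure (PhaseSpace N)) f f' (Eventually.of_forall fun q => hf' q.1 q.2)
      hcontf'.continuousAt hcontf.continuousAt hsurj
  rw [hf00] at hmin
  obtain ⟨ε₁, hε₁, hε₁V⟩ := Metric.mem_nhds_iff.1 hV
  -- the law of the SCALED skeleton dominates Lebesgue measure on the ball of radius `ρ₀`, uniformly
  obtain ⟨c₂, hc₂, hskel⟩ := exists_map_pairSkel_preimage_smul_ge m hc0 hcle ρ₀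
  -- the good remainders (smallness controlled through `c_max`)
  have hCpos : 0 < (cmax + cmax + 1) * (1 + 2 * 2 ^ m) := by positivity
  set ε' : ℝ := ε₁ / 2 / ((cmax + cmax + 1) * (1 + 2 * 2 ^ m)) with hε'
  have hε'pos : 0 < ε' := by positivity
  have hε'bound : (cmax + cmax) * ((1 + 2 * 2 ^ m) * ε') < ε₁ := by
    have h1 : (cmax + cmax) * ((1 + 2 * 2 ^ m) * ε') ≤ (cmax + cmax + 1) * ((1 + 2 * 2 ^ m) * ε') :=
      mul_le_mul_of_nonneg_right (by linarith) (by positivity)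
    have h2 : (cmax + cmax + 1) * ((1 + 2 * 2 ^ m) * ε') = ε₁ / 2 := by
      rw [hε']; field_simp
    linarith
  -- the set of good remainder pairs (countably many conditions: measurable)
  set GoodR : Set WienerPair := {rr | (∀ n k : ℕ, ((k : ℝ≥0) / 2 ^ n ≤ 1) →
      |rr.1 ((k : ℝ≥0) / 2 ^ n)| ≤ (1 + 2 * 2 ^ m) * ε' ∧ |rr.2 ((k : ℝ≥0) / 2 ^ n)| ≤ (1 + 2 * 2 ^ m) * ε')}
    with hGoodR
  have hGoodRm : MeasurableSet GoodR := by
    have : GoodR = ⋂ n : ℕ, ⋂ k : ℕ, {rr : WienerPair | ((k : ℝ≥0) / 2 ^ n ≤ 1) →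
        |rr.1 ((k : ℝ≥0) / 2 ^ n)| ≤ (1 + 2 * 2 ^ m) * ε' ∧ |rr.2 ((k : ℝ≥0) / 2 ^ n)| ≤ (1 + 2 * 2 ^ m) * ε'} := by
      ext rr; simp [hGoodR]
    rw [this]
    refine MeasurableSet.iInter fun n => MeasurableSet.iInter fun k => ?_
    by_cases hkn : (k : ℝ≥0) / 2 ^ n ≤ 1
    · simp only [hkn, forall_const]
      exact (measurableSet_le ((measurable_pi_apply _).comp measurable_fst).abs measurable_const).inter
        (measurableSet_le ((measurable_pi_apply _).comp measurable_snd).abs measurable_const)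
    · simp [hkn]
  -- the good event of the Brownian pair forces a good remainder
  have hgood_sub : goodEvent ε' 1 ⊆ (pairRem m) ⁻¹' GoodR := fun ω hω n k hk =>
    abs_pairRem_le_of_mem_goodEvent m hω hk
  have hgood_pos : 0 < wienerPair (goodEvent ε' 1) := wienerPair_goodEvent_pos hε'pos 1
  -- the constant
  refine ⟨ε₁, hε₁, r, hr, c₂ * c * wienerPair (goodEvent ε' 1),
    ENNReal.mul_pos (ENNReal.mul_pos hc₂.ne' hc.ne').ne' hgood_pos.ne',
    fun T_L T_R hL1 hL2 hR1 hR2 z hz T hT hTm => ?_⟩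
  set cL : ℝ := Real.sqrt (2 * γ * T_L) with hcL
  set cR : ℝ := Real.sqrt (2 * γ * T_R) with hcR
  have hcLa : |cL| ≤ cmax := by rw [abs_of_nonneg (Real.sqrt_nonneg _)]; exact hL2
  have hcRa : |cR| ≤ cmax := by rw [abs_of_nonneg (Real.sqrt_nonneg _)]; exact hR2
  -- the transition probability as a Wiener integral, factorised through the skeleton
  have hkernel : (pinnedChain ω₂ lam β γ).transitionKernel N T_L T_R 1 z T =
      wienerPair ((fun ω => (pinnedChain ω₂ lam β γ).solMap N T_L T_R 1 z (pairPath ω)) ⁻¹' T) := by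
    simpa using pinnedChain_transitionKernel_apply' hω hl hβ.le hγ.le N T_L T_R 1 z hTm
  -- the integrand `G(x, rr) = 1_T(Φ_1(z, PL x + rr)) 1_{GoodR}(rr)`
  have h1m := pinnedChain_measurable_solMap hω hl hβ.le hγ.le N T_L T_R (1 : ℝ)
  have h2m : Measurable fun q : PairSkeleton m × WienerPair => ((z : PhaseSpace N), pairRecon m q.1 q.2) :=
    measurable_const.prodMk (measurable_pairRecon m)
  have hsolm : Measurable ((fun p : PhaseSpace N × WienerPair =>
      (pinnedChain ω₂ lam β γ).solMap N T_L T_R 1 p.1 p.2) ∘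
      (fun q : PairSkeleton m × WienerPair => ((z : PhaseSpace N), pairRecon m q.1 q.2))) :=
    Measurable.comp h1m h2m
  let G : PairSkeleton m × WienerPair → ℝ≥0∞ := fun q =>
    ((T.indicator (1 : PhaseSpace N → ℝ≥0∞)) ∘ ((fun p : PhaseSpace N × WienerPair =>
      (pinnedChain ω₂ lam β γ).solMap N T_L T_R 1 p.1 p.2) ∘
      (fun q : PairSkeleton m × WienerPair => ((z : PhaseSpace N), pairRecon m q.1 q.2)))) q *
      GoodR.indicator 1 q.2
  have hGm : Measurable G :=
    ((measurable_one.indicator hTm).comp hsolm).mul ((measurable_one.indicator hGoodRm).comp measurable_snd)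
  -- `G(Ξ ω, R ω) ≤ 1_{Φ_1(z, B ω) ∈ T}`
  have hGle : ∀ ω, G (pairSkel m ω, pairRem m ω) ≤
      ((fun ω => (pinnedChain ω₂ lam β γ).solMap N T_L T_R 1 z (pairPath ω)) ⁻¹' T).indicator 1 ω := by
    intro ω
    simp only [G, Function.comp_apply]
    rw [pairRecon_pairSkel_pairRem]
    by_cases hmem : (pinnedChain ω₂ lam β γ).solMap N T_L T_R 1 z (pairPath ω) ∈ T
    · rw [indicator_of_mem hmem, indicator_of_mem (show ω ∈ (fun ω => (pinnedChain ω₂ lam β γ).solMap N T_L T_R 1 z (pairPath ω)) ⁻¹' T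
        from hmem)]
      rw [Pi.one_apply, one_mul]; exact indicator_le_self' (fun _ _ => zero_le_one) _
    · rw [indicator_of_notMem hmem, zero_mul]; exact zero_le
  -- for a good remainder of the Brownian pair, the inner integral is at least `c₂ c Leb(T)`
  have hinner : ∀ ω, pairRem m ω ∈ GoodR →
      c₂ * c * volume T ≤ ∫⁻ x, G (x, pairRem m ω) ∂(wienerPair.map (pairSkel m)) := by
    intro ω hωR
    set rr := pairRem m ω with hrr
    have hr1 : Continuous rr.1 := continuous_pairRem_fst m ω
    have hr2 : Continuous rr.2 := continuous_pairRem_snd m ω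
    obtain ⟨hr10, hr20⟩ := pairRem_apply_zero m ω
    -- the remainder noise path and its smallness
    have hcI : Continuous fun τ : I => (⟨(τ : ℝ), τ.2.1⟩ : ℝ≥0) := continuous_subtype_val.subtype_mk _
    let ρr : C(I, Fin N → ℝ) := ⟨fun τ i => (if i.val = 0 then cL else 0) * rr.1 ⟨(τ : ℝ), τ.2.1⟩ +
        (if i.val = N - 1 then cR else 0) * rr.2 ⟨(τ : ℝ), τ.2.1⟩, by
      refine continuous_pi fun i => ?_
      have h1 : Continuous fun τ : I => rr.1 ⟨(τ : ℝ), τ.2.1⟩ := hr1.comp hcI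
      have h2 : Continuous fun τ : I => rr.2 ⟨(τ : ℝ), τ.2.1⟩ := hr2.comp hcI
      fun_prop⟩
    have hρr : ∀ (τ : I) (i : Fin N), ρr τ i = (if i.val = 0 then cL else 0) * rr.1 ⟨(τ : ℝ), τ.2.1⟩ +
        (if i.val = N - 1 then cR else 0) * rr.2 ⟨(τ : ℝ), τ.2.1⟩ := fun τ i => rfl
    have hsmall : ∀ u : ℝ≥0, u ≤ 1 → |rr.1 u| ≤ (1 + 2 * 2 ^ m) * ε' ∧ |rr.2 u| ≤ (1 + 2 * 2 ^ m) * ε' :=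
      fun u hu => ⟨abs_le_of_dyadic hr1 (fun n k hk => (hωR n k hk).1) hu,
        abs_le_of_dyadic hr2 (fun n k hk => (hωR n k hk).2) hu⟩
    have hρnorm : ‖ρr‖ < ε₁ := by
      refine (ContinuousMap.norm_lt_iff _ hε₁).2 fun τ => ?_
      refine (pi_norm_le_iff_of_nonneg (by positivity)).2 (fun i => ?_) |>.trans_lt hε'bound
      rw [Real.norm_eq_abs, hρr]
      obtain ⟨h1, h2⟩ := hsmall ⟨(τ : ℝ), τ.2.1⟩ (by exact_mod_cast τ.2.2)
      have hL' : |(if i.val = 0 then cL else 0) * rr.1 ⟨(τ : ℝ), τ.2.1⟩| ≤ cmax * ((1 + 2 * 2 ^ m) * ε') := by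
        rw [abs_mul]
        refine mul_le_mul ?_ h1 (abs_nonneg _) hcmax.le
        split_ifs <;> simp [hcLa, hcmax.le]
      have hR' : |(if i.val = N - 1 then cR else 0) * rr.2 ⟨(τ : ℝ), τ.2.1⟩| ≤ cmax * ((1 + 2 * 2 ^ m) * ε') := by
        rw [abs_mul]
        refine mul_le_mul ?_ h2 (abs_nonneg _) hcmax.le
        split_ifs <;> simp [hcRa, hcmax.le]
      calc _ ≤ |(if i.val = 0 then cL else 0) * rr.1 ⟨(τ : ℝ), τ.2.1⟩| +
            |(if i.val = N - 1 then cR else 0) * rr.2 ⟨(τ : ℝ), τ.2.1⟩| := abs_add_le _ _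
        _ ≤ cmax * ((1 + 2 * 2 ^ m) * ε') + cmax * ((1 + 2 * 2 ^ m) * ε') := add_le_add hL' hR'
        _ = (cmax + cmax) * ((1 + 2 * 2 ^ m) * ε') := by ring
    -- `(z, ρr) ∈ V`
    have hzρ : ((z, ρr) : PhaseSpace N × C(I, Fin N → ℝ)) ∈ V := by
      refine hε₁V ?_
      rw [mem_ball, Prod.dist_eq, max_lt_iff, dist_zero_right, dist_zero_right]
      exact ⟨hz, hρnorm⟩
    -- the inner integrand is the indicator of `D⁻¹ {x | f (z, ρr) x ∈ T}`, `D x = (c_L x¹, c_R x²)`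
    have hGeq : ∀ x, G (x, rr) =
        ((fun x : PairSkeleton m => (cL • x.1, cR • x.2)) ⁻¹' ((f (z, ρr)) ⁻¹' T)).indicator 1 x := by
      intro x
      simp only [G, Function.comp_apply]
      rw [indicator_of_mem hωR, Pi.one_apply, mul_one,
        solMap_one_pairRecon_eq_skelSol_smul hω hl hβ.le hγ.le T_L T_R m η hη hSapply x hr1 hr2 hr10 hr20 ρr hρr z]
      rfl
    simp_rw [hGeq]
    have hfTm : MeasurableSet ((f (z, ρr)) ⁻¹' T) :=
      ((hf' (z, ρr) ·) |> fun h => (continuous_iff_continuousAt.2 fun x => (h x).continuousAt)).measurable hTm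
    have hDc : Continuous fun x : PairSkeleton m => (cL • x.1, cR • x.2) := by fun_prop
    have hpreTm : MeasurableSet ((fun x : PairSkeleton m => (cL • x.1, cR • x.2)) ⁻¹' ((f (z, ρr)) ⁻¹' T)) :=
      hfTm.preimage hDc.measurable
    rw [lintegral_indicator_one hpreTm]
    calc c₂ * c * volume T = c₂ * (c * volume T) := mul_assoc _ _ _
      _ ≤ c₂ * volume (closedBall (0 : PairSkeleton m) ρ₀ ∩ f (z, ρr) ⁻¹' T) :=
          mul_le_mul' le_rfl (hmin (z, ρr) hzρ T hT hTm)
      _ ≤ wienerPair.map (pairSkel m) ((fun x : PairSkeleton m => (cL • x.1, cR • x.2)) ⁻¹'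
            (closedBall (0 : PairSkeleton m) ρ₀ ∩ f (z, ρr) ⁻¹' T)) :=
          hskel cL cR hL1 hL2 hR1 hR2 _ inter_subset_left (measurableSet_closedBall.inter hfTm)
      _ ≤ wienerPair.map (pairSkel m) ((fun x : PairSkeleton m => (cL • x.1, cR • x.2)) ⁻¹' ((f (z, ρr)) ⁻¹' T)) :=
          measure_mono (preimage_mono inter_subset_right)
  -- assemble: Wiener integral ≥ factorised integral ≥ good part
  rw [hkernel, ← lintegral_indicator_one ((hTm.preimage
    (pinnedChain_measurable_solMap_pairPath_right hω hl hβ.le hγ.le N T_L T_R 1 z)))]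
  calc c₂ * c * wienerPair (goodEvent ε' 1) * volume T
      = c₂ * c * volume T * wienerPair (goodEvent ε' 1) := by ring
    _ ≤ c₂ * c * volume T * wienerPair ((pairRem m) ⁻¹' GoodR) := by
        gcongr
    _ = ∫⁻ ω, ((pairRem m) ⁻¹' GoodR).indicator (fun _ => c₂ * c * volume T) ω ∂wienerPair := by
        rw [lintegral_indicator_const (hGoodRm.preimage (measurable_pairRem m))]
    _ ≤ ∫⁻ ω, ∫⁻ x, G (x, pairRem m ω) ∂(wienerPair.map (pairSkel m)) ∂wienerPair := by
        refine lintegral_mono fun ω => ?_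
        by_cases hωR : pairRem m ω ∈ GoodR
        · rw [indicator_of_mem (show ω ∈ (pairRem m) ⁻¹' GoodR from hωR)]; exact hinner ω hωR
        · rw [indicator_of_notMem (show ω ∉ (pairRem m) ⁻¹' GoodR from hωR)]; exact zero_le
    _ = ∫⁻ ω, G (pairSkel m ω, pairRem m ω) ∂wienerPair := (lintegral_pairSkel_pairRem m hGm).symm
    _ ≤ ∫⁻ ω, ((fun ω => (pinnedChain ω₂ lam β γ).solMap N T_L T_R 1 z (pairPath ω)) ⁻¹' T).indicator 1 ω ∂wienerPair :=
        lintegral_mono hGle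

end One

/-- Registered helper sub-goal `helper_uniformLocalMinorization` of stmt-AtomisticToContinuum-11976
(= `pinnedChain_minorization_at_one_uniform`, fully quantified, notation-free one-line form). -/
theorem helper_uniformLocalMinorization : ∀ (ω₂ lam β γ : ℝ), 0 < ω₂ → 0 ≤ lam → 0 < β → 0 < γ → ∀ (N : ℕ), 0 < N → ∀ (cmin cmax : ℝ), 0 < cmin → cmin ≤ cmax → ∃ ε₁ : ℝ, 0 < ε₁ ∧ ∃ r : ℝ, 0 < r ∧ ∃ c : ENNReal, 0 < c ∧ ∀ T_L T_R : ℝ, cmin ≤ Real.sqrt (2 * γ * T_L) → Real.sqrt (2 * γ * T_L) ≤ cmax → cmin ≤ Real.sqrt (2 * γ * T_R) → Real.sqrt (2 * γ * T_R) ≤ cmax → ∀ z : Literature.MathematicalPhysics.KineticTheory.HeatConduction.PhaseSpace N, ‖z‖ < ε₁ → ∀ T ⊆ Metric.ball (0 : Literature.MathematicalPhysics.KineticTheory.HeatConduction.PhaseSpace N) r, MeasurableSet T → c * MeasureTheory.volume T ≤ (Literature.MathematicalPhysics.KineticTheory.HeatConduction.pinnedChain ω₂ lam β γ).transitionKernel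 N T_L T_R 1 z T :=
  fun _ _ _ _ hω hl hβ hγ _ hN _ _ hc0 hcle => pinnedChain_minorization_at_one_uniform hω hl hβ hγ hN hc0 hcle

end Summit.AtomisticToContinuum.FouriersLaw.Theorems.FixedLengthNoiseContinuity

end
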